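import Literature.Barriers.AtomisticToContinuum.DisorderedHarmonicChainSteadyState
import Literature.Barriers.AtomisticToContinuum.DisorderedHarmonicChainCurrentProofs
import HarnessLib

/-!
# The Casher–Lebowitz chain: `L* ρ = 0` as a matrix identity, and the final reduction of `AjankiHuveneers2011_scaling`

Companion to `DisorderedHarmonicChainSpectral.lean` (barrier catalogue
`Literature/Barriers/AtomisticToContinuum/`, sub-problem `FouriersLaw`; provefact unit of
`AjankiHuveneers2011_scaling`). Two things, all PROVED:

* The POINTWISE route to the stationary Fokker–Planck equation that complements the Stein
  route of `DisorderedHarmonicChainSteadyState.lean`: the formal-adjoint polynomial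
  `L*_B = clAdjointPoly B` of `DisorderedHarmonicChainGenerator.lean`
  (`∫ (L f) ρ_B = ∫ (L*_B) ρ_B f`) is, for every `B`, the matrix expression
  `-tr A + (A x♭)·(B x♭) - ½ tr(Σ B) + ½ (B x♭)·Σ(B x♭)` (`clAdjointPoly_eq`, `A = clDriftMatrix`,
  `Σ = clNoiseMatrix`), and this vanishes identically for `B = (clCov)⁻¹`
  (`clAdjointPoly_precision_eq_zero`) by the generic identity
  `adjointPoly_eq_zero_of_lyapunov`: `A C + C Aᵀ + Σ = 0`, `C P = P C = 1`, `Pᵀ = P` imply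
  `-tr A + (Az)·(Pz) - ½ tr(ΣP) + ½ (Pz)·Σ(Pz) = 0` (`P(AC + CAᵀ + Σ)P = PA + AᵀP + PΣP = 0`: its
  quadratic form is the `z`-dependent part, the trace of `C` times it the constant part) — the
  classical verification "`L* e^{-½xᵀB⁻¹x} = 0`" of Dhar 2008 §3.1 /
  Cuneo–Eckmann–Hairer–Rey-Bellet 2018 §3.1 for the linear chain.
* The CAPSTONE of the unit: with (F1a) `CasherLebowitz1971_steadyState_holds` and (F1b)
  `CasherLebowitz1971_currentFormula_holds` in the tree,
  `AjankiHuveneers2011_scaling_of_spectralScaling :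
     AjankiHuveneers2011_spectralScaling → AjankiHuveneers2011_scaling` — the vendored barrier
  fact (Ajanki–Huveneers 2011, Thm 1.1, on the SDE side) now rests on the single named fact
  `AjankiHuveneers2011_spectralScaling`, the theorem proper in the transmission-integral form in
  which the paper proves it (§2.1 (2.6)–(2.7), §§3–6 with O'Connor 1975 for the high frequencies).
-/

noncomputable section

open MeasureTheory Matrix
open scoped ContDiff

namespace Literature.Barriers.AtomisticToContinuum.HeatConduction

open Literature.MathematicalPhysics.KineticTheory.HeatConduction

/-! ### The formal adjoint of a linear Langevin generator vanishes on the Lyapunov Gaussian -/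

/-- **Generic matrix identity behind `L* ρ = 0`.** If `A C + C Aᵀ + S = 0` (Lyapunov), `C P = 1`,
`P C = 1` and `Pᵀ = P`, then for every vector `z`,
`-tr A + (A z)·(P z) - ½ tr(S P) + ½ (P z)·(S (P z)) = 0` — the polynomial
`ρ_P⁻¹ L* ρ_P` of the generator `L = (Az)·∇ + ½ S:∇²` against `ρ_P = e^{-zᵀPz/2}`. [folklore] -/
theorem adjointPoly_eq_zero_of_lyapunov {ι : Type*} [Fintype ι] [DecidableEq ι]
    {A S C P : Matrix ι ι ℝ} (hlyap : A * C + C * Aᵀ + S = 0) (hCP : C * P = 1)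
    (hPC : P * C = 1) (hPT : Pᵀ = P) (z : ι → ℝ) :
    -A.trace + (A *ᵥ z) ⬝ᵥ (P *ᵥ z) - (S * P).trace / 2 +
      (P *ᵥ z) ⬝ᵥ (S *ᵥ (P *ᵥ z)) / 2 = 0 := by
  -- `M := P A + Aᵀ P + P S P = P (A C + C Aᵀ + S) P = 0`
  have hM : P * A + Aᵀ * P + P * S * P = 0 := by
    have h := congrArg (fun X => P * X * P) hlyap
    simp only [Matrix.mul_add, Matrix.add_mul, Matrix.mul_zero, Matrix.zero_mul] at h
    have e1 : P * (A * C) * P = P * A := by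
      rw [Matrix.mul_assoc, Matrix.mul_assoc, hCP, Matrix.mul_one]
    have e2 : P * (C * Aᵀ) * P = Aᵀ * P := by
      rw [← Matrix.mul_assoc, hPC, Matrix.one_mul]
    rw [e1, e2] at h
    exact h
  -- quadratic part: `zᵀ M z = 2 (Az)·(Pz) + (Pz)·S(Pz) = 0`
  have hquad : (A *ᵥ z) ⬝ᵥ (P *ᵥ z) + (P *ᵥ z) ⬝ᵥ (S *ᵥ (P *ᵥ z)) / 2 = 0 := by
    have h := congrArg (fun X => z ⬝ᵥ (X *ᵥ z)) hM
    simp only [add_mulVec, dotProduct_add, zero_mulVec, dotProduct_zero, ← mulVec_mulVec] at h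
    -- `z ⬝ (P (A z)) = (P z) ⬝ (A z)`, `z ⬝ (Aᵀ (P z)) = (A z) ⬝ (P z)`, `z ⬝ (P (S (P z))) = (P z) ⬝ S (P z)`
    have t1 : z ⬝ᵥ (P *ᵥ (A *ᵥ z)) = (A *ᵥ z) ⬝ᵥ (P *ᵥ z) := by
      rw [dotProduct_mulVec, ← mulVec_transpose, hPT, dotProduct_comm]
    have t2 : z ⬝ᵥ (Aᵀ *ᵥ (P *ᵥ z)) = (A *ᵥ z) ⬝ᵥ (P *ᵥ z) := by
      rw [dotProduct_mulVec, ← mulVec_transpose, transpose_transpose]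
    have t3 : z ⬝ᵥ (P *ᵥ (S *ᵥ (P *ᵥ z))) = (P *ᵥ z) ⬝ᵥ (S *ᵥ (P *ᵥ z)) := by
      rw [dotProduct_mulVec, ← mulVec_transpose, hPT]
    rw [t1, t2, t3] at h
    linarith
  -- constant part: `tr (C M) = 2 tr A + tr (S P) = 0`
  have hconst : A.trace + (S * P).trace / 2 = 0 := by
    have h := congrArg (fun X => (C * X).trace) hM
    simp only [Matrix.mul_add, Matrix.mul_zero, trace_zero, trace_add] at h
    have e1 : (C * (P * A)).trace = A.trace := by
      rw [← Matrix.mul_assoc, hCP, Matrix.one_mul]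
    have e2 : (C * (Aᵀ * P)).trace = A.trace := by
      rw [← Matrix.mul_assoc, trace_mul_comm, ← Matrix.mul_assoc, hPC, Matrix.one_mul,
        trace_transpose]
    have e3 : (C * (P * S * P)).trace = (S * P).trace := by
      rw [Matrix.mul_assoc P S P, ← Matrix.mul_assoc, hCP, Matrix.one_mul]
    rw [e1, e2, e3] at h
    linarith
  linarith

/-! ### The formal adjoint polynomial of the Casher–Lebowitz chain in matrix form -/

variable {n : ℕ}

/-- The noise matrix is the diagonal matrix `diag(0 ⊕ (2λ m_i T_i))`. [folklore] -/
theorem clNoiseMatrix_eq_diagonal (m : Fin n → ℝ) (lam T_L T_R : ℝ) :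
    clNoiseMatrix m lam T_L T_R =
      Matrix.diagonal (Sum.elim 0 (fun i => 2 * lam * m i * bathTemp n T_L T_R i)) := by
  ext a b
  rcases a with i | i <;> rcases b with j | j <;> simp [clNoiseMatrix, diagonal_apply]

/-- The trace of the drift matrix: `tr A = -λ ∑_i ([i=0]+[i=n-1])`. [folklore] -/
theorem trace_clDriftMatrix (m : Fin n → ℝ) (lam : ℝ) :
    (clDriftMatrix m lam).trace = -(lam * ∑ i, (bathMult n i : ℝ)) := by
  simp only [Matrix.trace, Matrix.diag, clDriftMatrix, Fintype.sum_sum_type, fromBlocks_apply₁₁,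
    fromBlocks_apply₂₂, Matrix.zero_apply, Finset.sum_const_zero, zero_add, Matrix.neg_apply,
    frictionMatrix, diagonal_apply_eq, Finset.sum_neg_distrib, Finset.mul_sum]

/-- `(A x♭)` of the chain: `(A x♭)_{q_i} = p_i/m_i`, `(A x♭)_{p_i} = -(Φ_D q)_i - λ([i=0]+[i=n-1]) p_i`.
[folklore] -/
theorem clDriftMatrix_mulVec_flat (m : Fin n → ℝ) (lam : ℝ) (x : PhaseSpace n) :
    clDriftMatrix m lam *ᵥ flat x =
      Sum.elim (fun i => (m i)⁻¹ * x.2 i)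
        (fun i => -((clForceMatrix n *ᵥ x.1) i) - lam * bathMult n i * x.2 i) := by
  have h : flat x = Sum.elim x.1 x.2 := rfl
  rw [clDriftMatrix, h, fromBlocks_mulVec]
  ext a
  rcases a with i | i
  · simp [mulVec_diagonal]
  · simp [neg_mulVec, mulVec_diagonal, frictionMatrix, sub_eq_add_neg]

/-- **The adjoint polynomial in matrix form**: for every matrix `B`,
`L*_B(x) = -tr A + (A x♭)·(B x♭) - ½ tr(Σ B) + ½ (B x♭)·Σ(B x♭)` with `A = clDriftMatrix m λ`,
`Σ = clNoiseMatrix m λ T_L T_R`. [folklore] -/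
theorem clAdjointPoly_eq (B : Matrix (Fin n ⊕ Fin n) (Fin n ⊕ Fin n) ℝ) (m : Fin n → ℝ)
    (lam T_L T_R : ℝ) (x : PhaseSpace n) :
    clAdjointPoly B m lam T_L T_R x =
      -(clDriftMatrix m lam).trace + (clDriftMatrix m lam *ᵥ flat x) ⬝ᵥ (B *ᵥ flat x) -
        (clNoiseMatrix m lam T_L T_R * B).trace / 2 +
          (B *ᵥ flat x) ⬝ᵥ (clNoiseMatrix m lam T_L T_R *ᵥ (B *ᵥ flat x)) / 2 := by
  set w := B *ᵥ flat x with hw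
  have hw_split : w = Sum.elim (fun i => w (Sum.inl i)) (fun i => w (Sum.inr i)) := by
    ext a; rcases a with i | i <;> rfl
  -- the four matrix expressions as sums over the sites
  have hT : -(clDriftMatrix m lam).trace = lam * ∑ i, (bathMult n i : ℝ) := by
    rw [trace_clDriftMatrix, neg_neg]
  have hA : (clDriftMatrix m lam *ᵥ flat x) ⬝ᵥ w =
      ∑ i, ((m i)⁻¹ * x.2 i * w (Sum.inl i) +
        (-((clForceMatrix n *ᵥ x.1) i) - lam * bathMult n i * x.2 i) * w (Sum.inr i)) := by
    rw [clDriftMatrix_mulVec_flat, hw_split, sumElim_dotProduct_sumElim]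
    simp only [dotProduct, ← Finset.sum_add_distrib]
    rfl
  have hS : (clNoiseMatrix m lam T_L T_R * B).trace =
      ∑ i, 2 * lam * m i * bathTemp n T_L T_R i * B (Sum.inr i) (Sum.inr i) := by
    rw [clNoiseMatrix_eq_diagonal]
    simp only [Matrix.trace, Matrix.diag, diagonal_mul, Fintype.sum_sum_type, Sum.elim_inl,
      Pi.zero_apply, zero_mul, Finset.sum_const_zero, zero_add, Sum.elim_inr]
  have hQ : w ⬝ᵥ (clNoiseMatrix m lam T_L T_R *ᵥ w) =
      ∑ i, 2 * lam * m i * bathTemp n T_L T_R i * w (Sum.inr i) ^ 2 := by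
    rw [clNoiseMatrix_eq_diagonal]
    simp only [dotProduct, mulVec_diagonal, Fintype.sum_sum_type, Sum.elim_inl, Pi.zero_apply,
      zero_mul, mul_zero, Finset.sum_const_zero, zero_add, Sum.elim_inr]
    exact Finset.sum_congr rfl fun i _ => by ring
  rw [hT, hA, hS, hQ]
  -- both sides as a single sum over the sites
  unfold clAdjointPoly
  rw [← hw]
  rw [Finset.mul_sum, Finset.mul_sum, ← Finset.sum_add_distrib, Finset.sum_div, Finset.sum_div,
    ← Finset.sum_add_distrib, ← Finset.sum_sub_distrib, ← Finset.sum_add_distrib]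
  refine Finset.sum_congr rfl fun i _ => ?_
  have hq : w (Sum.inl i) = (B *ᵥ flat x) (Sum.inl i) := rfl
  have hp : w (Sum.inr i) = (B *ᵥ flat x) (Sum.inr i) := rfl
  simp only [bathMult, bathTemp]
  split_ifs <;> field_simp <;> ring

/-- **`L* ρ = 0` for the Lyapunov Gaussian of the Casher–Lebowitz chain.** For `m > 0`, `λ > 0`,
`T_L, T_R > 0` and `B = clCov m λ T_L T_R`, the adjoint polynomial against the precision
`B⁻¹` vanishes identically. [cite: Dhar2008, §3.1] -/
theorem clAdjointPoly_precision_eq_zero {m : Fin n → ℝ} (hm : ∀ k, 0 < m k) {lam : ℝ}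
    (hlam : 0 < lam) {T_L T_R : ℝ} (hL : 0 < T_L) (hR : 0 < T_R) (x : PhaseSpace n) :
    clAdjointPoly (clCov m lam T_L T_R)⁻¹ m lam T_L T_R x = 0 := by
  set C := clCov m lam T_L T_R with hC
  have hCpd : C.PosDef := clCov_posDef hm hlam hL hR
  have hunit : IsUnit C.det := (isUnit_iff_isUnit_det _).mp hCpd.isUnit
  have hCP : C * C⁻¹ = 1 := mul_nonsing_inv _ hunit
  have hPC : C⁻¹ * C = 1 := nonsing_inv_mul _ hunit
  have hCT : Cᵀ = C := clCov_transpose hm hlam T_L T_R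
  have hPT : (C⁻¹)ᵀ = C⁻¹ := by rw [transpose_nonsing_inv, hCT]
  rw [clAdjointPoly_eq]
  exact adjointPoly_eq_zero_of_lyapunov (clCov_lyapunov hm hlam T_L T_R) hCP hPC hPT (flat x)

/-- **The pointwise route to the stationary Fokker–Planck equation**: for `m > 0`, `λ > 0`,
`T_L, T_R > 0`, `B = clCov m λ T_L T_R` and every test function `f ∈ C²_c`,
`∫ (L f) e^{-½ x♭ᵀB⁻¹x♭} dq dp = 0` (`∫ (L f) ρ = ∫ (L*ρ/ρ) ρ f` and `L*ρ/ρ ≡ 0`). This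
re-proves the stationarity clause of `CasherLebowitz1971_steadyState_holds` through
`clAdjointPoly` instead of Stein's identity. [cite: Dhar2008, §3.1] -/
theorem cl_integral_generator_mul_gaussDensity_precision_eq_zero {m : Fin n → ℝ}
    (hm : ∀ k, 0 < m k) {lam : ℝ} (hlam : 0 < lam) {T_L T_R : ℝ} (hL : 0 < T_L) (hR : 0 < T_R)
    {f : PhaseSpace n → ℝ} (hf : ContDiff ℝ 2 f) (hfc : HasCompactSupport f) :
    ∫ x, clGenerator m lam T_L T_R f x * gaussDensity (clCov m lam T_L T_R)⁻¹ x = 0 := by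
  have hCT : (clCov m lam T_L T_R)ᵀ = clCov m lam T_L T_R := clCov_transpose hm hlam T_L T_R
  have hPT : ((clCov m lam T_L T_R)⁻¹)ᵀ = (clCov m lam T_L T_R)⁻¹ := by
    rw [transpose_nonsing_inv, hCT]
  rw [cl_integral_generator_mul_gaussDensity _ hPT m lam T_L T_R hf hfc]
  simp [clAdjointPoly_precision_eq_zero hm hlam hL hR]

end Literature.Barriers.AtomisticToContinuum.HeatConduction

namespace Literature.Barriers.AtomisticToContinuum

open Literature.MathematicalPhysics.KineticTheory.HeatConduction HeatConduction

/-- **`AjankiHuveneers2011_scaling` reduced to the Ajanki–Huveneers theorem proper.** With (F1a)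
(`CasherLebowitz1971_steadyState_holds`, `DisorderedHarmonicChainSteadyState.lean`) and (F1b)
(`CasherLebowitz1971_currentFormula_holds`, `DisorderedHarmonicChainCurrentProofs.lean`)
discharged, the vendored SDE-side fact follows from the transmission-integral form of
Theorem 1.1 alone: the trust base of `AjankiHuveneers2011_scaling` is the single named fact
`AjankiHuveneers2011_spectralScaling`. [cite: AjankiHuveneers2011, Thm 1.1 with §2.1 eqs. (2.5)-(2.7) and §6] -/
theorem AjankiHuveneers2011_scaling_of_spectralScaling (h : AjankiHuveneers2011_spectralScaling) :
    AjankiHuveneers2011_scaling :=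
  AjankiHuveneers2011_scaling_of_spectral CasherLebowitz1971_steadyState_holds
    CasherLebowitz1971_currentFormula_holds h

end Literature.Barriers.AtomisticToContinuum

end
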